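import Literature.MathematicalPhysics.QuantumFieldTheory.Balaban1983to89.Beta.Assembly
import Literature.MathematicalPhysics.QuantumFieldTheory.Balaban1983to89.Beta.LogDetHessian
import Literature.MathematicalPhysics.QuantumFieldTheory.Balaban1983to89.B12Normalization
import Literature.MathematicalPhysics.QuantumFieldTheory.Balaban1983to89.Beta.AliasingTail
import Literature.MathematicalPhysics.QuantumFieldTheory.Balaban1983to89.Beta.AliasingTailL1

/-!
# `Balaban1983to89.Beta.Certified` — the EXPORT SOCKET of the computer-assisted one-loop lane (β sub-cell, seats
cap1/cap2/cap3) into `Beta.Assembly`: a CERTIFICATE CARRIER for the finite list (AF-0s)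
`3β⁰_∞/4 ≤ β⁰_{k+1}, k < k₁`, the kernel arithmetic turning certified rational enclosures into the hypothesis `hsmall`
of `Assembly.LimitForm.thm2Printed_of_list` / `thm2Printed`, the SU(2), L = 3 threshold numbers, the equipartition
trace identity of the bordered (KKT) block inverse, and the arithmetic of the abelian closed form.

CITATION HEADER (lean-in-tree rule 2026-08-18).  Source under audit: T. Bałaban, *Renormalization group approach to
lattice gauge field theories. I.*, Commun. Math. Phys. **109**, 249–301 (1987), doi:10.1007/bf01215223
[Balaban1987RG1] (cell paper B12; held `paper:balaban1987-cmp109-rg-i-small-field`, journal page = PDF page + 248).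
Locators used: (1.22) p. 264 (β⁰_{k+1} as a second moment of the one-loop vacuum-polarisation kernel), (2.12)–(2.14)
p. 268 (the one-loop split `β_{k+1} = β⁰_{k+1} + β¹_{k+1}`, `B12Beta.OneLoopSplit`), Theorem 2 p. 259 with (0.31)
(`B12.Thm2Printed`), (0.20) p. 256 (units; `B12Normalization.stepBal`); T. Bałaban, *Propagators for lattice gauge
theories in a background field*, Commun. Math. Phys. **99**, 389–434 (1985) [Balaban1985BackgroundPropagators] (B9)
(3.158) p. 428 (the constrained covariance, MODEL object `LogDetHessian.cov`).  No formula is newly quoted in this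
module: every printed input enters through `Beta.Assembly`, `Beta.LogDetHessian`, `B12Normalization`, whose citation
headers carry the verbatim quotations; Mathlib's certified decimal enclosures `Real.pi_gt_d6`/`Real.pi_lt_d6`
(through `B12Normalization.const_bal_two_bounds`) and `Real.log_three_gt_d9`/`Real.log_three_lt_d9` supply §3.

HONEST FRAMING (cell rule, verbatim, page 1 of everything): discharging BetaPertH makes Bałaban's UV stability
UNCONDITIONAL — a real constructive-QFT result; it is NOT the continuum limit and NOT the Clay problem.

ABSOLUTE RULE (cell rule, verbatim): "No internally-minted statement may enter as a cited fact. Every hypothesis is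
either kernel-proved in this package or a verbatim quotation of a PUBLISHED theorem with page reference."  In this
module NOTHING is asserted about the values of Bałaban's coefficients `β⁰_{k+1}` of (1.22): a certified enclosure
`lo_k ≤ β⁰_{k+1}` produced OUTSIDE the kernel (certified interval arithmetic, two independent engines, certificate
hashes recorded in the certificate registry `run/shared/lean/pub/pub-balaban/BETA/CAP-KERNEL.md` §7, v0 of 2026-08-19,
empty at v0) can only ever enter as the FIELD `lo_le` of
the carrier `SmallKCert` — a HYPOTHESIS of kind COMPUTATIONAL, displayed as such wherever it is consumed; the kernel
then does the exact rational comparison with the threshold and the bookkeeping into `Assembly`.  Whether such a leaf is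
admissible under (AF-0s) at END grade is the β-lead's ruling, not this file's — and it HAS been ruled (RULING (R15),
cell journal 2026-08-19T05:54:22Z; BETA/WALL.md §7; BETA/NUMERICS-BETA.md p. 1 and §3C/§4: "numerics: evidence only,
never load-bearing"): certified numbers are kit-grade EVIDENCE and at most INSTANTIATIONS of existing binders at fixed
parameters; this module is a CHECKER (certificate-decoding data + soundness theorems concluding existing tree predicates at
explicit rational endpoints); it discharges NO wall binder.  INDEX GLOSSARY (cell referee R-cap-6): `SmallKCert.k₁` is
the LENGTH of the certified list ("k_list"; bounds for `k < k₁`, rate hypothesis at exponent `k₁`) — not the anchor index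
of `Beta.RateCertificate` ("k_anchor"), and not `Assembly.LimitForm.k₀` (the `Nat.find` threshold; `thm2Printed_of_cert_k₀`
takes `D.k₀ ≤ c.k₁`).

WHAT IS HERE.
§1 `SmallKCert b binf` — DATA `k₁`, rational lower bounds `lo : ℕ → ℚ`, a rational `bhi ≥ binf`, and HYPOTHESES
   `lo_le : ∀ k < k₁, lo k ≤ b k` (the computational leaf) and `thr_le : ∀ k < k₁, 3·bhi/4 ≤ lo k` (decidable rational
   comparisons, discharged by `norm_num` / `decide` on a concrete list); `SmallKCert.hsmall : ∀ k < k₁, 3·binf/4 ≤ b k`;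
   the one- and two-entry constructors `SmallKCert.one` / `SmallKCert.two` (the realistic sizes: k₁ = k₀ ≤ 2 once the
   asymptotic lane supplies `c₀θ^{k₁} ≤ β⁰_∞/4`).
§2 EXPORT into `Assembly.LimitForm`: `hsmall_of_cert`, `thm2Printed_of_cert` (with the rate hypothesis
   `c₀θ^{k₁} ≤ binf/4` at the certificate's own `k₁` — `Assembly.LimitForm.thm2Printed_of_list`), `thm2Printed_of_cert_k₀`
   and `betaAFH_of_cert` (when `k₀ ≤ k₁`), `beta0_pos_all_of_cert`.
§3 SU(2), L = 3 (the lane's first case): `stepBal_two_three_bounds : 0.40814 < stepBal 2 3 < 0.40815`, hence the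
   threshold `3·stepBal 2 3/4 < 0.30612` (`threshold_two_three_lt`); a SHAPE DEMONSTRATION (`example`, abstract `b`,
   placeholder hypothesis) that a one-entry certificate closes `hsmall` by `norm_num` — no value is asserted.
§4 EQUIPARTITION: for a bordered matrix `[[H, E],[D, 0]]` with two-sided inverse `[[Γ, X],[Y, Z]]` over any commutative
   ring, `tr(HΓ) = |n| − |m|` (`trace_mul_topLeft_eq`); in the vocabulary of `LogDetHessian` (`cov Δ C = C(CᵀΔC)⁻¹Cᵀ`,
   B9 (3.158) as a MODEL object): `tr(Δ·cov Δ C) = |ν|` (`trace_mul_cov`) and `|ν| = |κ| − |τ|` (`card_kernel_eq`).  This is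
   the kernel of the "T7" identity of the numerics seats (cell file b2b-balaban-beta-num/NUM-C.md §2 (2.6): total one-loop
   fluctuation variance per cell and PER LIE-ALGEBRA (colour) COMPONENT = number of fluctuation degrees of freedom per colour
   component = 3(L⁴−1) in the complete axial gauge, `dof_count`; for SU(2) the real count per cell is 3·3(L⁴−1)).
§5 ABELIAN ARITHMETIC: `abelianCoeff L k = (L⁴−1)/(4L^{4(k+1)})` — the closed form found NUMERICALLY for G = U(1) by the
   numerics seat (cell file b2b-balaban-beta-num/NUM-C.md §4.5, reproduced to ≤ 1e-8 at six (L,k)) and DERIVED in prose in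
   BETA/CAP-KERNEL.md §3 (v0, 2026-08-19) MODULO a uniformity lemma (U) whose proof is only sketched there — so its status
   is "derived modulo (U)", NOT "proved" (cell referee R-cap-5); HERE ONLY ITS ARITHMETIC (positivity, the telescoping
   partial sums `(1 − L^{−4K})/4`, the values 15/64, 20/81, 15/1024, the series value 1/4, and the CONTROL `abelianCoeff L k → 0`:
   the abelian coefficient admits no k-uniform positive lower bound), never an assertion that it equals Bałaban's β⁰_{k+1}
   for any group.
§6 THE ALIASING LEAF (v0.2, 2026-08-19): `aliasConst_le` (monotone rational-friendly majorant of `AliasingTail.aliasConst`), `exp_neg_le_inv_sum`,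
   `lo_le_of_aliasing` (strip regularity + an engine ball for the torus grid mean + a tail majorant ⇒ `lo ≤ Re latticeKernel G 0`),
   `SmallKCert.oneOfAliasing` (the length-1 certificate under the normalisation identification `b 0 = Re latticeKernel G 0`, a
   HYPOTHESIS), and the worked size `aliasConst (9/10) 20 3 ≤ (Σ_{i<40} 18^i/i!)⁻¹·((3 − 1/90)/(1 − 1/90))⁴ ≈ 1.27e-6` (so at
   period N = 20 and strip half-width 0.9 a sup bound M ≤ 2·10⁵ keeps the aliasing tail under 0.25; BETA/CAP-KERNEL.md §4.8–4.10).
   v0.3 (2026-08-19): the ℓ¹-RATE worked sizes of the sharper leaf `AliasingTailL1` (slice holomorphy through complex base points ⇒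
   `‖K(x)‖ ≤ M e^{−κ|x|₁}`, tail constant `aliasConstL1 κ N d = ((1 + e^{−κN})/(1 − e^{−κN}))^{d+1} − 1`): `aliasRatioL1 (9/10) 16 ≤ 1/1 700 000`,
   `aliasConstL1 (9/10) 16 3 ≤ ((1 + 1/1 700 000)/(1 − 1/1 700 000))⁴ − 1 ≤ 1/212 000` (≈ 4.7e-6, against `aliasConst (9/10) 16 3 ≈ 4.9e-5`) and
   `aliasConstL1 (9/10) 20 3 ≤ ((1 + 1/65 000 000)/(1 − 1/65 000 000))⁴ − 1 ≤ 1/8 120 000` (≈ 1.23e-7) — so at N = 16 a sup bound `M ≤ 600`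
   keeps the ℓ¹ tail under `3·10⁻³` (the export inequality is `AliasingTailL1.lo_le_of_aliasing_l1`, same shape as `lo_le_of_aliasing`).
   Every analytic / numerical input of the lane stays a HYPOTHESIS of these declarations (RULING R15-1); no `def … : Prop` is added.
Value = kernel-checked export interface + located computational leaf, NOT summit progress (audit cell `pub-balaban`,
β sub-cell, β-PERT ACCELERATION lane cap3 = kernel algebra + export, unit `b2b-balaban-beta-cap3`).
-/

namespace Literature.MathematicalPhysics.QuantumFieldTheory.Balaban1983to89.Beta.Certified

open Literature.MathematicalPhysics.QuantumFieldTheory.Balaban1983to89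
open Literature.MathematicalPhysics.QuantumFieldTheory.Balaban1983to89.FlowStep
open Literature.MathematicalPhysics.QuantumFieldTheory.Balaban1983to89.Beta.Assembly
open Literature.MathematicalPhysics.QuantumFieldTheory.Balaban1983to89.DagBinding
open Literature.MathematicalPhysics.QuantumFieldTheory.Balaban1983to89.FlowStepRuns
open Literature.MathematicalPhysics.QuantumFieldTheory.Balaban1983to89.B12Normalization
open scoped Matrix

noncomputable section

/-! ## §1 The certificate carrier for the finite list (AF-0s) -/

/-- **Certificate carrier for the finite list (AF-0s)** over an abstract sequence `b : ℕ → ℝ` (intended: `b = D.S.β0`,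
Bałaban's one-loop coefficients `β⁰_{k+1}` of (2.12)–(2.14)) and an abstract limit value `binf` (intended: `D.binf`):
DATA `k₁`, `lo`, `bhi` and HYPOTHESES `lo_le` (the COMPUTATIONAL leaf: certified enclosures produced outside the kernel —
nothing about Bałaban's family is asserted by having this structure), `binf_le` (a rational upper bound of the limit
coefficient, e.g. from `stepBal` enclosures when `binf = stepBal N L`), `thr_le` (exact rational comparisons).
[cite: Balaban1987RG1, (2.12)–(2.14) p.268 and (1.22) p.264] -/
structure SmallKCert (b : ℕ → ℝ) (binf : ℝ) where
  /-- length of the certified list: the bounds concern `k < k₁`. -/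
  k₁ : ℕ
  /-- certified rational lower bounds `lo k ≤ b k`, `k < k₁`. -/
  lo : ℕ → ℚ
  /-- COMPUTATIONAL LEAF (hypothesis): the certified enclosures, produced by interval arithmetic outside the kernel. -/
  lo_le : ∀ k, k < k₁ → ((lo k : ℚ) : ℝ) ≤ b k
  /-- a rational upper bound of the limit coefficient. -/
  bhi : ℚ
  binf_le : binf ≤ (bhi : ℝ)
  /-- the threshold comparisons `3·bhi/4 ≤ lo k`, `k < k₁` (decidable over ℚ). -/
  thr_le : ∀ k, k < k₁ → 3 * bhi / 4 ≤ lo k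

namespace SmallKCert

variable {b : ℕ → ℝ} {binf : ℝ} (c : SmallKCert b binf)

/-- The list (AF-0s) in the strength `Assembly.LimitForm.thm2Printed_of_list` consumes: `3·binf/4 ≤ b k` for `k < k₁`.
[folklore] -/
theorem hsmall : ∀ k, k < c.k₁ → 3 * binf / 4 ≤ b k := by
  intro k hk
  have h1 : ((3 * c.bhi / 4 : ℚ) : ℝ) ≤ ((c.lo k : ℚ) : ℝ) := by exact_mod_cast c.thr_le k hk
  have h2 : (3 * binf / 4 : ℝ) ≤ ((3 * c.bhi / 4 : ℚ) : ℝ) := by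
    push_cast; linarith [c.binf_le]
  exact h2.trans (h1.trans (c.lo_le k hk))

/-- Positivity of the listed coefficients when `binf > 0`. [folklore] -/
theorem pos (hbinf : 0 < binf) : ∀ k, k < c.k₁ → 0 < b k :=
  fun k hk => lt_of_lt_of_le (by linarith) (c.hsmall k hk)

/-- Restriction of a certificate to a shorter list. [folklore] -/
def restrict (k₂ : ℕ) (hk : k₂ ≤ c.k₁) : SmallKCert b binf where
  k₁ := k₂
  lo := c.lo
  lo_le := fun k h => c.lo_le k (lt_of_lt_of_le h hk)
  bhi := c.bhi
  binf_le := c.binf_le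
  thr_le := fun k h => c.thr_le k (lt_of_lt_of_le h hk)

/-- ONE-ENTRY certificate (`k₁ = 1`): a certified `q₀ ≤ b 0`, an upper bound `binf ≤ bhi`, and `3·bhi/4 ≤ q₀`. [folklore] -/
def one (q₀ bhi : ℚ) (h₀ : ((q₀ : ℚ) : ℝ) ≤ b 0) (hb : binf ≤ (bhi : ℝ)) (hthr : 3 * bhi / 4 ≤ q₀) :
    SmallKCert b binf where
  k₁ := 1
  lo := fun _ => q₀
  lo_le := fun k hk => by
    have : k = 0 := by omega
    subst this; exact h₀
  bhi := bhi
  binf_le := hb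
  thr_le := fun _ _ => hthr

/-- TWO-ENTRY certificate (`k₁ = 2`). [folklore] -/
def two (q₀ q₁ bhi : ℚ) (h₀ : ((q₀ : ℚ) : ℝ) ≤ b 0) (h₁ : ((q₁ : ℚ) : ℝ) ≤ b 1) (hb : binf ≤ (bhi : ℝ))
    (hthr₀ : 3 * bhi / 4 ≤ q₀) (hthr₁ : 3 * bhi / 4 ≤ q₁) : SmallKCert b binf where
  k₁ := 2
  lo := fun k => if k = 0 then q₀ else q₁
  lo_le := fun k hk => by
    rcases Nat.lt_succ_iff_lt_or_eq.mp hk with h | h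
    · have : k = 0 := by omega
      subst this; simpa using h₀
    · subst h; simpa using h₁
  bhi := bhi
  binf_le := hb
  thr_le := fun k _ => by
    by_cases h : k = 0 <;> simp [h, hthr₀, hthr₁]

/-- `(one …).k₁ = 1`. [folklore] -/
@[simp] theorem one_k₁ (q₀ bhi : ℚ) (h₀ : ((q₀ : ℚ) : ℝ) ≤ b 0) (hb : binf ≤ (bhi : ℝ)) (hthr : 3 * bhi / 4 ≤ q₀) :
    (one q₀ bhi h₀ hb hthr).k₁ = 1 := rfl

/-- `(two …).k₁ = 2`. [folklore] -/
@[simp] theorem two_k₁ (q₀ q₁ bhi : ℚ) (h₀ : ((q₀ : ℚ) : ℝ) ≤ b 0) (h₁ : ((q₁ : ℚ) : ℝ) ≤ b 1)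
    (hb : binf ≤ (bhi : ℝ)) (hthr₀ : 3 * bhi / 4 ≤ q₀) (hthr₁ : 3 * bhi / 4 ≤ q₁) :
    (two q₀ q₁ bhi h₀ h₁ hb hthr₀ hthr₁).k₁ = 2 := rfl

end SmallKCert

/-! ## §2 Export into `Assembly.LimitForm` -/

section Export

variable {β : HBeta} (D : LimitForm β)

/-- The hypothesis `hsmall` of `Assembly.LimitForm.thm2Printed_of_list` from a certificate on `D.S.β0`, `D.binf`.
[folklore] -/
theorem hsmall_of_cert (c : SmallKCert D.S.β0 D.binf) : ∀ k, k < c.k₁ → 3 * D.binf / 4 ≤ D.S.β0 k :=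
  c.hsmall

/-- **Theorem 2 as printed from the limit form + a certificate of length `k₁` + the rate inequality at `k₁`**
(`c₀θ^{k₁} ≤ β⁰_∞/4`, the asymptotic lane's deliverable): `Assembly.LimitForm.thm2Printed_of_list`.
[cite: Balaban1987RG1, Thm 2 p.259 with (0.31)] -/
theorem thm2Printed_of_cert (c : SmallKCert D.S.β0 D.binf) (hk₁ : D.c₀ * D.θ ^ c.k₁ ≤ D.binf / 4)
    {C : B12.Construction} (hgen : ForwardGenerated C β) {L : ℝ} (hL : 1 < L) : B12.Thm2Printed C L :=
  D.thm2Printed_of_list hgen hL hk₁ c.hsmall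

/-- The same with the MINIMAL index `k₀` of the limit form, for any certificate at least that long.
[cite: Balaban1987RG1, Thm 2 p.259 with (0.31)] -/
theorem thm2Printed_of_cert_k₀ (c : SmallKCert D.S.β0 D.binf) (hk : D.k₀ ≤ c.k₁)
    {C : B12.Construction} (hgen : ForwardGenerated C β) {L : ℝ} (hL : 1 < L) : B12.Thm2Printed C L :=
  D.thm2Printed hgen hL fun k hk' => c.hsmall k (lt_of_lt_of_le hk' hk)

/-- Discrete asymptotic freedom `BetaAFH β` from the limit form + a certificate covering `k < k₀`. [folklore] -/
theorem betaAFH_of_cert (c : SmallKCert D.S.β0 D.binf) (hk : D.k₀ ≤ c.k₁) : BetaAFH β :=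
  D.betaAFH_of_smallList fun k hk' => c.hsmall k (lt_of_lt_of_le hk' hk)

/-- (AF-0) on the explicit box `]0, γ₁]` with constant `β⁰_∞/2`, from a certificate and the rate inequality at its `k₁`.
[folklore] -/
theorem betaLowerH_of_cert (c : SmallKCert D.S.β0 D.binf) (hk₁ : D.c₀ * D.θ ^ c.k₁ ≤ D.binf / 4) :
    BetaLowerH (D.binf / 2) D.γ₁ β :=
  D.betaLowerH_of_list hk₁ c.hsmall

/-- All one-loop coefficients are positive, from a certificate covering `k < k₀`. [folklore] -/
theorem beta0_pos_all_of_cert (c : SmallKCert D.S.β0 D.binf) (hk : D.k₀ ≤ c.k₁) : ∀ k, 0 < D.S.β0 k :=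
  D.beta0_pos_all fun k hk' => c.pos D.binf_pos k (lt_of_lt_of_le hk' hk)

/-- All one-loop coefficients satisfy `3β⁰_∞/4 ≤ β⁰_{k+1}`, from a certificate covering `k < k₀`. [folklore] -/
theorem beta0_lower_all_of_cert (c : SmallKCert D.S.β0 D.binf) (hk : D.k₀ ≤ c.k₁) :
    ∀ k, 3 * D.binf / 4 ≤ D.S.β0 k :=
  D.beta0_lower_all fun k hk' => c.hsmall k (lt_of_lt_of_le hk' hk)

end Export

/-! ## §3 SU(2), L = 3: the threshold numbers of the lane's first case -/

section ThresholdSU2L3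

/-- SU(2), `L = 3`: `0.40814 < stepBal 2 3 = (11/3π²)·log 3 < 0.40815` (Mathlib's `1.0986122885 < log 3 < 1.0986122888`
and `B12Normalization.const_bal_two_bounds`). [folklore] -/
theorem stepBal_two_three_bounds : (0.40814 : ℝ) < stepBal 2 3 ∧ stepBal 2 3 < 0.40815 := by
  rw [stepBal_two]
  obtain ⟨hc1, hc2⟩ := const_bal_two_bounds
  have hl1 := Real.log_three_gt_d9
  have hl2 := Real.log_three_lt_d9
  constructor <;> nlinarith

/-- Hence the (AF-0s) threshold for SU(2), L = 3 in Bałaban's units: `3·stepBal 2 3/4 < 0.30612`. [folklore] -/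
theorem threshold_two_three_lt : 3 * stepBal 2 3 / 4 < (0.30612 : ℝ) := by
  have := stepBal_two_three_bounds.2
  linarith

/-- … and from below `0.30610 < 3·stepBal 2 3/4` (so a certified `lo₀` must exceed `0.3061…`; the numerics seats'
non-certified reading is `β⁰₁ ≈ 0.661`, BETA/NUMERICS-BETA.md §3C/§4 — EVIDENCE, not an input). [folklore] -/
theorem lt_threshold_two_three : (0.30610 : ℝ) < 3 * stepBal 2 3 / 4 := by
  have := stepBal_two_three_bounds.1
  linarith

/-- `stepBal 2 3 ≤ 0.40815` in the form the carrier's field `binf_le` wants when `binf = stepBal 2 3`. [folklore] -/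
theorem stepBal_two_three_le : stepBal 2 3 ≤ ((40815 / 100000 : ℚ) : ℝ) := by
  have := stepBal_two_three_bounds.2
  push_cast
  linarith

/-- SHAPE DEMONSTRATION ONLY (abstract `b`, PLACEHOLDER hypothesis `h₀` — no value of any coefficient is asserted): a
one-entry certificate with `lo₀ = 13/20` against `binf = stepBal 2 3` closes the list `k < 1` by exact rational
arithmetic. [folklore] -/
example (b : ℕ → ℝ) (h₀ : (((13 / 20 : ℚ) : ℚ) : ℝ) ≤ b 0) : ∀ k, k < 1 → 3 * stepBal 2 3 / 4 ≤ b k :=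
  (SmallKCert.one (b := b) (binf := stepBal 2 3) (13 / 20) (40815 / 100000) h₀ stepBal_two_three_le
    (by norm_num)).hsmall

end ThresholdSU2L3

end

/-! ## §4 Equipartition: the trace identity of the bordered block inverse -/

section Equipartition

variable {R : Type*} [CommRing R] {n m : Type*} [Fintype n] [Fintype m] [DecidableEq n] [DecidableEq m]

/-- **Equipartition identity.**  If the bordered matrix `[[H, E],[D, 0]]` has the right inverse `[[Γ, X],[Y, Z]]` (hence
two-sided, `mul_eq_one_comm`), then `tr(H·Γ) = |n| − |m|`: from the blocks `HΓ + EY = 1` and `YE = 1` and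
`tr(EY) = tr(YE)`.  (For the constrained Gaussian `∫ δ(Qv − w) e^{−½⟨v,Hv⟩} dv`, `Γ` is the fluctuation covariance and
`tr(HΓ)` the expected quadratic action: every constrained degree of freedom carries ½.) [folklore] -/
theorem trace_mul_topLeft_eq (H : Matrix n n R) (E : Matrix n m R) (D : Matrix m n R) (Γ : Matrix n n R)
    (X : Matrix n m R) (Y : Matrix m n R) (Z : Matrix m m R)
    (h : Matrix.fromBlocks H E D 0 * Matrix.fromBlocks Γ X Y Z = 1) :
    (H * Γ).trace = Fintype.card n - Fintype.card m := by
  have h' := mul_eq_one_comm.mp h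
  rw [Matrix.fromBlocks_multiply, ← Matrix.fromBlocks_one] at h h'
  obtain ⟨h11, -, -, -⟩ := Matrix.fromBlocks_inj.mp h
  obtain ⟨-, -, -, h22⟩ := Matrix.fromBlocks_inj.mp h'
  rw [Matrix.mul_zero, add_zero] at h22
  have t1 : (H * Γ).trace + (E * Y).trace = Fintype.card n := by
    rw [← Matrix.trace_add, h11, Matrix.trace_one]
  have t2 : (E * Y).trace = Fintype.card m := by
    rw [Matrix.trace_mul_comm, h22, Matrix.trace_one]
  rw [← t2]
  exact eq_sub_of_add_eq t1

/-- The same for a two-sided inverse in Mathlib's `⁻¹` form: if `[[H, E],[D, 0]]` is invertible and its inverse is written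
in blocks, `tr(H·(top-left block)) = |n| − |m|`. [folklore] -/
theorem trace_mul_topLeft_inv (H : Matrix n n R) (E : Matrix n m R) (D : Matrix m n R)
    (hK : IsUnit (Matrix.fromBlocks H E D 0).det) :
    (H * (Matrix.fromBlocks H E D 0)⁻¹.toBlocks₁₁).trace = Fintype.card n - Fintype.card m := by
  set K := Matrix.fromBlocks H E D 0 with hKdef
  have hinv : K * K⁻¹ = 1 := Matrix.mul_nonsing_inv K hK
  have hblk : K⁻¹ = Matrix.fromBlocks K⁻¹.toBlocks₁₁ K⁻¹.toBlocks₁₂ K⁻¹.toBlocks₂₁ K⁻¹.toBlocks₂₂ :=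
    (Matrix.fromBlocks_toBlocks _).symm
  rw [hblk] at hinv
  exact trace_mul_topLeft_eq H E D _ _ _ _ hinv

end Equipartition

section EquipartitionCov

open LogDetHessian

variable {κ ν τ : Type*} [Fintype κ] [Fintype ν] [Fintype τ] [DecidableEq ν]

/-- In the vocabulary of `LogDetHessian` (B9 (3.158) as a MODEL object, `cov Δ C = C(CᵀΔC)⁻¹Cᵀ` for a basis `C` of
`ker Q`): `tr(Δ · cov Δ C) = |ν|` — the number of constrained fluctuation degrees of freedom — by cyclicity alone.
[cite: Balaban1985BackgroundPropagators, (3.158) p.428] -/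
theorem trace_mul_cov (Δ : Matrix κ κ ℝ) (C : Matrix κ ν ℝ) (hΓ : IsUnit (Cᵀ * Δ * C).det) :
    (Δ * cov Δ C).trace = Fintype.card ν := by
  unfold cov
  calc (Δ * (C * (Cᵀ * Δ * C)⁻¹ * Cᵀ)).trace = ((Cᵀ * Δ * C) * (Cᵀ * Δ * C)⁻¹).trace := by
        rw [show Δ * (C * (Cᵀ * Δ * C)⁻¹ * Cᵀ) = (Δ * C * (Cᵀ * Δ * C)⁻¹) * Cᵀ by
              simp only [Matrix.mul_assoc], Matrix.trace_mul_comm]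
        simp only [Matrix.mul_assoc]
    _ = Fintype.card ν := by rw [Matrix.mul_nonsing_inv _ hΓ, Matrix.trace_one]

omit [DecidableEq ν] in
/-- The dimension count `|ν| = |κ| − |τ|` for complementary index types `κ ≃ ν ⊕ τ` (fluctuation dofs = all dofs −
constraints). [folklore] -/
theorem card_kernel_eq (e : κ ≃ ν ⊕ τ) : (Fintype.card ν : ℤ) = Fintype.card κ - Fintype.card τ := by
  have := Fintype.card_congr e
  rw [Fintype.card_sum] at this
  omega

/-- Hence, under the hypotheses of `LogDetHessian.kkt_mul_blockInv`, `tr(Δ · cov Δ C) = |κ| − |τ|`. [folklore] -/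
theorem trace_mul_cov_eq_sub (e : κ ≃ ν ⊕ τ) (Δ : Matrix κ κ ℝ) (C : Matrix κ ν ℝ)
    (hΓ : IsUnit (Cᵀ * Δ * C).det) : (Δ * cov Δ C).trace = Fintype.card κ - Fintype.card τ := by
  rw [trace_mul_cov Δ C hΓ]
  exact_mod_cast card_kernel_eq e

/-- The DOF COUNT behind "T7 = 3(L⁴−1)" (cell file b2b-balaban-beta-num/NUM-C.md §2 (2.6)), PER COLOUR (Lie-algebra)
COMPONENT: per L⁴-cell, 4L⁴ bond variables minus the L⁴−1 tree bonds of the complete axial gauge minus the 4 averaging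
constraints leave `3(L⁴−1)` constrained fluctuation degrees of freedom per colour component (the axial tree and the
averaging constraint are Lie-algebra valued, so for SU(2) the real count per cell is `3·3(L⁴−1)`; cell referee R-cap-7).
[folklore] -/
theorem dof_count (L : ℕ) : (4 * (L : ℤ) ^ 4 - ((L : ℤ) ^ 4 - 1)) - 4 = 3 * ((L : ℤ) ^ 4 - 1) := by ring

end EquipartitionCov

/-! ## §5 The abelian closed form: arithmetic only -/

section Abelian

/-- `abelianCoeff L k = (L⁴ − 1)/(4·L^{4(k+1)})` — the closed form DERIVED for the one-loop step coefficient of the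
(k+1)-st averaging step for the gauge group U(1) (cell files b2b-balaban-beta-num/NUM-C.md §4.5 — numerically — and
BETA/CAP-KERNEL.md §3 — derived modulo the uniformity lemma (U), not proved); a rational function of (L, k), recorded
here for its ARITHMETIC only. [folklore] -/
def abelianCoeff (L k : ℕ) : ℚ := ((L : ℚ) ^ 4 - 1) / (4 * (L : ℚ) ^ (4 * (k + 1)))

/-- `L = 2, k = 0`: `15/64`. [folklore] -/
theorem abelianCoeff_two_zero : abelianCoeff 2 0 = 15 / 64 := by norm_num [abelianCoeff]

/-- `L = 2, k = 1`: `15/1024`. [folklore] -/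
theorem abelianCoeff_two_one : abelianCoeff 2 1 = 15 / 1024 := by norm_num [abelianCoeff]

/-- `L = 3, k = 0`: `20/81`. [folklore] -/
theorem abelianCoeff_three_zero : abelianCoeff 3 0 = 20 / 81 := by norm_num [abelianCoeff]

/-- `L = 3, k = 1`: `20/6561`. [folklore] -/
theorem abelianCoeff_three_one : abelianCoeff 3 1 = 20 / 6561 := by norm_num [abelianCoeff]

/-- Positivity for `L ≥ 2`. [folklore] -/
theorem abelianCoeff_pos {L : ℕ} (hL : 2 ≤ L) (k : ℕ) : 0 < abelianCoeff L k := by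
  unfold abelianCoeff
  have hL' : (2 : ℚ) ≤ L := by exact_mod_cast hL
  have h4 : (1 : ℚ) < (L : ℚ) ^ 4 := by
    have : (1 : ℚ) < L := by linarith
    exact one_lt_pow₀ this (by norm_num)
  have hden : (0 : ℚ) < 4 * (L : ℚ) ^ (4 * (k + 1)) := by positivity
  exact div_pos (by linarith) hden

/-- The recursion `abelianCoeff L (k+1) = abelianCoeff L k / L⁴`. [folklore] -/
theorem abelianCoeff_succ {L : ℕ} (hL : L ≠ 0) (k : ℕ) :
    abelianCoeff L (k + 1) = abelianCoeff L k / (L : ℚ) ^ 4 := by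
  unfold abelianCoeff
  have hL' : (L : ℚ) ≠ 0 := by exact_mod_cast hL
  rw [show 4 * (k + 1 + 1) = 4 * (k + 1) + 4 by ring, pow_add]
  field_simp

/-- TELESCOPING: `Σ_{k<K} abelianCoeff L k = (1 − L^{−4K})/4` (the (k+1)-st step removes the fraction
`(1 − L⁻⁴)L^{−4k}` of the total `1/4`). [folklore] -/
theorem sum_range_abelianCoeff {L : ℕ} (hL : L ≠ 0) (K : ℕ) :
    ∑ k ∈ Finset.range K, abelianCoeff L k = (1 - 1 / (L : ℚ) ^ (4 * K)) / 4 := by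
  have hL' : (L : ℚ) ≠ 0 := by exact_mod_cast hL
  induction K with
  | zero => simp
  | succ K ih =>
    rw [Finset.sum_range_succ, ih]
    unfold abelianCoeff
    rw [show 4 * (K + 1) = 4 * K + 4 by ring, pow_add]
    field_simp
    ring

/-- Hence every partial sum is `< 1/4` and the composite coefficient after `K` steps is `(1 − L^{−4K})/4`
(`15/64`, `255/1024` at L = 2; `20/81` at L = 3 — the values the numerics seats' engines reproduce, cell file
b2b-balaban-beta-num-g2/NUM-C2.md §4 M).
[folklore] -/
theorem sum_range_abelianCoeff_lt {L : ℕ} (hL : 2 ≤ L) (K : ℕ) :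
    ∑ k ∈ Finset.range K, abelianCoeff L k < 1 / 4 := by
  rw [sum_range_abelianCoeff (by omega) K]
  have hL' : (0 : ℚ) < (L : ℚ) ^ (4 * K) := by positivity
  have : 0 < 1 / (L : ℚ) ^ (4 * K) := by positivity
  linarith

/-- `L = 2`, two steps: `255/1024`. [folklore] -/
theorem sum_range_two_abelianCoeff_two : ∑ k ∈ Finset.range 2, abelianCoeff 2 k = 255 / 1024 := by
  rw [sum_range_abelianCoeff (by norm_num)]; norm_num

/-- The full series: `Σ_k abelianCoeff L k = 1/4` for `L ≥ 2` (geometric series with ratio `L⁻⁴`). [folklore] -/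
theorem hasSum_abelianCoeff {L : ℕ} (hL : 2 ≤ L) :
    HasSum (fun k => ((abelianCoeff L k : ℚ) : ℝ)) (1 / 4) := by
  have hL0 : (L : ℝ) ≠ 0 := by exact_mod_cast (show L ≠ 0 by omega)
  have hLpos : (0 : ℝ) < L := by exact_mod_cast (show 0 < L by omega)
  set r : ℝ := ((L : ℝ) ^ 4)⁻¹ with hr
  have hr0 : 0 ≤ r := by positivity
  have hr1 : r < 1 := by
    rw [hr]
    have h4 : (1 : ℝ) < (L : ℝ) ^ 4 := by
      have : (1 : ℝ) < L := by exact_mod_cast (show 1 < L by omega)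
      exact one_lt_pow₀ this (by norm_num)
    exact inv_lt_one_of_one_lt₀ h4
  have hgeom := (hasSum_geometric_of_lt_one hr0 hr1).mul_left (((L : ℝ) ^ 4 - 1) / (4 * (L : ℝ) ^ 4))
  have hval : ((L : ℝ) ^ 4 - 1) / (4 * (L : ℝ) ^ 4) * (1 - r)⁻¹ = 1 / 4 := by
    rw [hr]
    have h4 : (L : ℝ) ^ 4 - 1 ≠ 0 := by
      have : (1 : ℝ) < (L : ℝ) ^ 4 := one_lt_pow₀ (by exact_mod_cast (show 1 < L by omega)) (by norm_num)
      linarith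
    field_simp
  rw [hval] at hgeom
  have heq : (fun k => ((abelianCoeff L k : ℚ) : ℝ)) =
      fun k => ((L : ℝ) ^ 4 - 1) / (4 * (L : ℝ) ^ 4) * r ^ k := by
    funext k
    rw [hr]
    unfold abelianCoeff
    push_cast
    rw [show 4 * (k + 1) = 4 * k + 4 by ring, pow_add, inv_pow, ← pow_mul]
    field_simp
  rw [heq]
  exact hgeom

/-- CONTROL (cell referee's recommendation): the abelian coefficient tends to `0` — so it admits NO `k`-uniform positive
lower bound, and any argument producing a uniform lower bound for a β-function without a non-abelian input is refuted by
this lemma (for `L ≥ 2`; the terms of a convergent series tend to zero). [folklore] -/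
theorem tendsto_abelianCoeff_zero {L : ℕ} (hL : 2 ≤ L) :
    Filter.Tendsto (fun k => ((abelianCoeff L k : ℚ) : ℝ)) Filter.atTop (nhds 0) :=
  (hasSum_abelianCoeff hL).summable.tendsto_atTop_zero

/-- CONTROL, ε-form: for every `ε > 0` some abelian coefficient is `< ε` (`L ≥ 2`). [folklore] -/
theorem exists_abelianCoeff_lt {L : ℕ} (hL : 2 ≤ L) {ε : ℝ} (hε : 0 < ε) :
    ∃ k, ((abelianCoeff L k : ℚ) : ℝ) < ε := by
  have h := (tendsto_abelianCoeff_zero hL).eventually (gt_mem_nhds hε)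
  obtain ⟨k, hk⟩ := h.exists
  exact ⟨k, hk⟩

/-- CONTROL, uniform-bound form: no `m > 0` bounds all abelian coefficients from below (`L ≥ 2`). [folklore] -/
theorem not_exists_uniform_pos_lower_bound {L : ℕ} (hL : 2 ≤ L) :
    ¬ ∃ m : ℝ, 0 < m ∧ ∀ k, m ≤ ((abelianCoeff L k : ℚ) : ℝ) := by
  rintro ⟨m, hm, hle⟩
  obtain ⟨k, hk⟩ := exists_abelianCoeff_lt hL hm
  exact absurd (hle k) (not_le.mpr hk)

end Abelian

/-! ## §6 The ALIASING LEAF (v0.2): a certified `lo ≤ b 0` from a finite torus computation + the tail bound of `AliasingTail`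

The computer-assisted lane produces, for ONE coefficient, four things OUTSIDE the kernel (cell file BETA/CAP-KERNEL.md §4.4,
§4.8; all of them enter here as HYPOTHESES — RULING R15-1: certified numerics are evidence / instantiations of existing binders,
never Literature facts, and this module stays a CHECKER):
 (N) the NORMALISATION identification `b 0 = Re (latticeKernel G 0)` of the coefficient with the Brillouin-zone mean of a
     one-loop integrand `G` (BETA/NORMALISATIONS; a dictionary statement, not a number);
 (Z) strip regularity `StripRegular G κ M` ((Z1) zero-freeness of the fibre symbol on the polystrip `|Im q_μ| ≤ κ` and (Z2) the
     sup bound `M`, certified by interval arithmetic);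
 (T) an ENGINE ENCLOSURE `‖T_N − t‖ ≤ r` of the torus grid mean `T_N = torusKernel (descendC G …) N 0` (two engines);
 (A) a real `A ≥ M · aliasConst κ N d` (from `aliasConst_le` below and rational arithmetic) and a rational `lo ≤ t − r − A`.
Then `lo ≤ b 0` (`lo_le_of_aliasing`), which is exactly the leaf `SmallKCert.one` consumes (`SmallKCert.oneOfAliasing`).
[folklore] -/
section Aliasing

open AliasingTail

/-- `(3 − ρ)/(1 − ρ) = 1 + 2/(1 − ρ)` is monotone in `ρ < 1`. [folklore] -/
theorem three_sub_div_one_sub_mono {ρ ρ' : ℝ} (h : ρ ≤ ρ') (h1 : ρ' < 1) :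
    (3 - ρ) / (1 - ρ) ≤ (3 - ρ') / (1 - ρ') := by
  have hρ : 0 < 1 - ρ := by linarith
  have hρ' : 0 < 1 - ρ' := by linarith
  rw [div_le_div_iff₀ hρ hρ']
  nlinarith

/-- `0 ≤ (3 − ρ)/(1 − ρ)` for `ρ < 1`. [folklore] -/
theorem three_sub_div_one_sub_nonneg {ρ : ℝ} (h1 : ρ < 1) : 0 ≤ (3 - ρ) / (1 - ρ) :=
  div_nonneg (by linarith) (by linarith)

/-- `e^{−y} ≤ (Σ_{i<n} y^i/i!)⁻¹` for `y ≥ 0`, `n ≥ 1` (partial sums of `e^{y}`; `Real.sum_le_exp_of_nonneg`). [folklore] -/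
theorem exp_neg_le_inv_sum {y : ℝ} (hy : 0 ≤ y) {n : ℕ} (hn : 1 ≤ n) :
    Real.exp (-y) ≤ (∑ i ∈ Finset.range n, y ^ i / (i.factorial : ℝ))⁻¹ := by
  have hs : ∑ i ∈ Finset.range n, y ^ i / (i.factorial : ℝ) ≤ Real.exp y := Real.sum_le_exp_of_nonneg hy n
  have hpos : 0 < ∑ i ∈ Finset.range n, y ^ i / (i.factorial : ℝ) := by
    have h0 : (1 : ℝ) ≤ ∑ i ∈ Finset.range n, y ^ i / (i.factorial : ℝ) := by
      calc (1 : ℝ) = ∑ i ∈ Finset.range 1, y ^ i / (i.factorial : ℝ) := by simp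
        _ ≤ ∑ i ∈ Finset.range n, y ^ i / (i.factorial : ℝ) := by
          apply Finset.sum_le_sum_of_subset_of_nonneg (Finset.range_mono hn)
          intro i _ _; positivity
    linarith
  rw [Real.exp_neg]
  exact inv_anti₀ hpos hs

/-- the alias ratio `ρ = e^{−κN/(d+1)}` is bounded by inverse partial sums. [folklore] -/
theorem aliasRatio_le_inv_sum {κ : ℝ} (hκ : 0 ≤ κ) (N d : ℕ) {n : ℕ} (hn : 1 ≤ n) :
    aliasRatio κ N d ≤ (∑ i ∈ Finset.range n, (κ * N / (d + 1)) ^ i / (i.factorial : ℝ))⁻¹ := by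
  unfold aliasRatio
  exact exp_neg_le_inv_sum (by positivity) hn

/-- MONOTONE MAJORANT of the alias constant: `ρ ≤ ρ' < 1` and `e^{−κN} ≤ e'` give
`aliasConst κ N d ≤ e' · ((3 − ρ')/(1 − ρ'))^{d+1}`. [folklore] -/
theorem aliasConst_le {κ : ℝ} {N d : ℕ} {ρ' e' : ℝ} (hρ : aliasRatio κ N d ≤ ρ') (hρ1 : ρ' < 1)
    (he : Real.exp (-(κ * N)) ≤ e') :
    aliasConst κ N d ≤ e' * ((3 - ρ') / (1 - ρ')) ^ (d + 1) := by
  unfold aliasConst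
  have hr1 : aliasRatio κ N d < 1 := lt_of_le_of_lt hρ hρ1
  have h1 : (3 - aliasRatio κ N d) / (1 - aliasRatio κ N d) ≤ (3 - ρ') / (1 - ρ') :=
    three_sub_div_one_sub_mono hρ hρ1
  have h0 : 0 ≤ (3 - aliasRatio κ N d) / (1 - aliasRatio κ N d) := three_sub_div_one_sub_nonneg hr1
  have hp : ((3 - aliasRatio κ N d) / (1 - aliasRatio κ N d)) ^ (d + 1) ≤ ((3 - ρ') / (1 - ρ')) ^ (d + 1) :=
    pow_le_pow_left₀ h0 h1 _
  have hp0 : 0 ≤ ((3 - aliasRatio κ N d) / (1 - aliasRatio κ N d)) ^ (d + 1) := pow_nonneg h0 _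
  have he0 : 0 ≤ Real.exp (-(κ * N)) := (Real.exp_pos _).le
  calc Real.exp (-(κ * N)) * ((3 - aliasRatio κ N d) / (1 - aliasRatio κ N d)) ^ (d + 1)
      ≤ e' * ((3 - aliasRatio κ N d) / (1 - aliasRatio κ N d)) ^ (d + 1) :=
        mul_le_mul_of_nonneg_right he hp0
    _ ≤ e' * ((3 - ρ') / (1 - ρ')) ^ (d + 1) := mul_le_mul_of_nonneg_left hp (he0.trans he)

variable {d : ℕ}

/-- THE ALIASING LEAF.  Strip regularity (Z), an engine ball (T) for the grid mean at period `N ≥ 1`, a majorant `A` of the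
tail `M · aliasConst κ N d` and a rational `lo ≤ t − r − A` give `lo ≤ Re (latticeKernel G 0)`. [folklore] -/
theorem lo_le_of_aliasing {G : (Fin (d + 1) → ℂ) → ℂ} {κ M : ℝ}
    (h : B4ContourShift.StripRegular G κ M) (hκ : 0 < κ) {N : ℕ} (hN : 1 ≤ N) {t r : ℝ}
    (hT : ‖B4TorusKernel.torusKernel (B4TorusKernel.descendC G h hκ.le) N 0 - t‖ ≤ r)
    {A : ℝ} (hA : M * aliasConst κ N d ≤ A) {lo : ℚ} (hlo : ((lo : ℚ) : ℝ) ≤ t - r - A) :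
    ((lo : ℚ) : ℝ) ≤ (B4ContourShift.latticeKernel G 0).re := by
  have := latticeKernel_zero_re_ge h hκ hN hT
  linarith

/-- The one-coefficient certificate from the aliasing leaf: with the normalisation identification (N) `b 0 = Re c`,
`c = latticeKernel G 0`, the list `(AF-0s)` of length 1 follows from (Z), (T), (A) and the two rational comparisons. [folklore] -/
def SmallKCert.oneOfAliasing {b : ℕ → ℝ} {binf : ℝ} {G : (Fin (d + 1) → ℂ) → ℂ} {κ M : ℝ}
    (hb : b 0 = (B4ContourShift.latticeKernel G 0).re)
    (h : B4ContourShift.StripRegular G κ M) (hκ : 0 < κ) {N : ℕ} (hN : 1 ≤ N) {t r : ℝ}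
    (hT : ‖B4TorusKernel.torusKernel (B4TorusKernel.descendC G h hκ.le) N 0 - t‖ ≤ r)
    {A : ℝ} (hA : M * aliasConst κ N d ≤ A) (lo bhi : ℚ) (hlo : ((lo : ℚ) : ℝ) ≤ t - r - A)
    (hbinf : binf ≤ (bhi : ℝ)) (hthr : 3 * bhi / 4 ≤ lo) : SmallKCert b binf :=
  SmallKCert.one lo bhi (by rw [hb]; exact lo_le_of_aliasing h hκ hN hT hA hlo) hbinf hthr

/-- and its length is 1. [folklore] -/
theorem SmallKCert.oneOfAliasing_k₁ {b : ℕ → ℝ} {binf : ℝ} {G : (Fin (d + 1) → ℂ) → ℂ} {κ M : ℝ}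
    (hb : b 0 = (B4ContourShift.latticeKernel G 0).re)
    (h : B4ContourShift.StripRegular G κ M) (hκ : 0 < κ) {N : ℕ} (hN : 1 ≤ N) {t r : ℝ}
    (hT : ‖B4TorusKernel.torusKernel (B4TorusKernel.descendC G h hκ.le) N 0 - t‖ ≤ r)
    {A : ℝ} (hA : M * aliasConst κ N d ≤ A) (lo bhi : ℚ) (hlo : ((lo : ℚ) : ℝ) ≤ t - r - A)
    (hbinf : binf ≤ (bhi : ℝ)) (hthr : 3 * bhi / 4 ≤ lo) :
    (SmallKCert.oneOfAliasing hb h hκ hN hT hA lo bhi hlo hbinf hthr).k₁ = 1 := rfl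

/-- SIZE OF THE TAIL at the working point of CAP-KERNEL §4.8 (a = κ = 9/10, d + 1 = 4, N = 20): the alias ratio is below
`1/90` and `e^{−18} ≤ 1/(Σ_{i<40} 18^i/i!)`, whence `aliasConst (9/10) 20 3 ≤ (Σ_{i<40} 18^i/i!)⁻¹ · ((3 − 1/90)/(1 − 1/90))^4`
— a closed rational bound the kernel evaluates (`norm_num`); numerically ≈ 1.3e-6 (so a sup bound `M ≤ 2·10^5` keeps the tail
below `0.25`). [folklore] -/
theorem aliasRatio_nine_tenths_twenty_three_le : aliasRatio (9 / 10) 20 3 ≤ 1 / 90 := by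
  have h := aliasRatio_le_inv_sum (κ := 9 / 10) (by norm_num) 20 3 (n := 18) (by norm_num)
  refine h.trans ?_
  have h20 : ((20 : ℕ) : ℝ) = 20 := by norm_num
  have h3 : ((3 : ℕ) : ℝ) = 3 := by norm_num
  rw [h20, h3]
  simp only [Finset.sum_range_succ, Finset.sum_range_zero, Nat.factorial]
  norm_num

/-- the closed rational majorant of `aliasConst (9/10) 20 3` (≈ 1.27e-6). [folklore] -/
theorem aliasConst_nine_tenths_twenty_three_le :
    aliasConst (9 / 10) 20 3 ≤
      (∑ i ∈ Finset.range 40, (18 : ℝ) ^ i / (i.factorial : ℝ))⁻¹ * ((3 - 1 / 90) / (1 - 1 / 90)) ^ (3 + 1) := by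
  have he : Real.exp (-((9 : ℝ) / 10 * (20 : ℕ))) ≤ (∑ i ∈ Finset.range 40, (18 : ℝ) ^ i / (i.factorial : ℝ))⁻¹ := by
    rw [show ((9 : ℝ) / 10 * (20 : ℕ)) = 18 by push_cast; norm_num]
    exact exp_neg_le_inv_sum (by norm_num) (by norm_num)
  exact aliasConst_le aliasRatio_nine_tenths_twenty_three_le (by norm_num) he

/-! ### ℓ¹-rate worked sizes (v0.3) — for the sharper leaf `AliasingTailL1` (`lo_le_of_aliasing_l1`). -/

open Literature.MathematicalPhysics.QuantumFieldTheory.Balaban1983to89.Beta.AliasingTailL1 in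
/-- ℓ¹ WORKED SIZE at the route-C working point (a = κ = 9/10, N = 16): `e^{−72/5} ≤ 1/1 700 000`. [folklore] -/
theorem aliasRatioL1_nine_tenths_sixteen_le : aliasRatioL1 (9 / 10) 16 ≤ 1 / 1700000 := by
  unfold aliasRatioL1
  have he : Real.exp (-((9 : ℝ) / 10 * (16 : ℕ))) ≤ (∑ i ∈ Finset.range 30, ((72 : ℝ) / 5) ^ i / (i.factorial : ℝ))⁻¹ := by
    rw [show ((9 : ℝ) / 10 * (16 : ℕ)) = 72 / 5 by push_cast; norm_num]
    exact exp_neg_le_inv_sum (by norm_num) (by norm_num)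
  refine he.trans ?_
  simp only [Finset.sum_range_succ, Finset.sum_range_zero, Nat.factorial]
  norm_num

open Literature.MathematicalPhysics.QuantumFieldTheory.Balaban1983to89.Beta.AliasingTailL1 in
/-- the closed rational majorant of `aliasConstL1 (9/10) 16 3` (≈ 4.7e-6; exact value ≈ 4.46e-6; `aliasConst (9/10) 16 3 ≈ 4.9e-5`). [folklore] -/
theorem aliasConstL1_nine_tenths_sixteen_three_le :
    aliasConstL1 (9 / 10) 16 3 ≤ ((1 + 1 / 1700000) / (1 - 1 / 1700000)) ^ (3 + 1) - 1 :=
  aliasConstL1_le aliasRatioL1_nine_tenths_sixteen_le (by norm_num)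

open Literature.MathematicalPhysics.QuantumFieldTheory.Balaban1983to89.Beta.AliasingTailL1 in
/-- ℓ¹ WORKED SIZE at N = 20: `e^{−18} ≤ 1/65 000 000`. [folklore] -/
theorem aliasRatioL1_nine_tenths_twenty_le : aliasRatioL1 (9 / 10) 20 ≤ 1 / 65000000 := by
  unfold aliasRatioL1
  have he : Real.exp (-((9 : ℝ) / 10 * (20 : ℕ))) ≤ (∑ i ∈ Finset.range 40, (18 : ℝ) ^ i / (i.factorial : ℝ))⁻¹ := by
    rw [show ((9 : ℝ) / 10 * (20 : ℕ)) = 18 by push_cast; norm_num]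
    exact exp_neg_le_inv_sum (by norm_num) (by norm_num)
  refine he.trans ?_
  simp only [Finset.sum_range_succ, Finset.sum_range_zero, Nat.factorial]
  norm_num

open Literature.MathematicalPhysics.QuantumFieldTheory.Balaban1983to89.Beta.AliasingTailL1 in
/-- the closed rational majorant of `aliasConstL1 (9/10) 20 3` (≈ 1.23e-7; `aliasConst (9/10) 20 3 ≈ 1.27e-6`). [folklore] -/
theorem aliasConstL1_nine_tenths_twenty_three_le :
    aliasConstL1 (9 / 10) 20 3 ≤ ((1 + 1 / 65000000) / (1 - 1 / 65000000)) ^ (3 + 1) - 1 :=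
  aliasConstL1_le aliasRatioL1_nine_tenths_twenty_le (by norm_num)

/-- the two majorants as plain rationals: below `1/212 000` (N = 16) and `1/8 120 000` (N = 20). [folklore] -/
example : ((1 + 1 / 1700000 : ℝ) / (1 - 1 / 1700000)) ^ (3 + 1) - 1 ≤ 1 / 212000 := by norm_num
example : ((1 + 1 / 65000000 : ℝ) / (1 - 1 / 65000000)) ^ (3 + 1) - 1 ≤ 1 / 8120000 := by norm_num

end Aliasing

end Literature.MathematicalPhysics.QuantumFieldTheory.Balaban1983to89.Beta.Certified
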